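import Summits.CriticalPhenomena.PercolationContinuityZ3.Theorems.PercNearOneGluingNoHeavyLowerTailSunflowerMultiPetalDemotionKey
import Summits.CriticalPhenomena.PercolationContinuityZ3.Theorems.PercNearOneGluingNoHeavyLowerTailSunflowerMultiPetalHomeRouting
import Summits.CriticalPhenomena.PercolationContinuityZ3.Theorems.PercNearOneGluingNoHeavyLowerTailSunflowerMultiPetalSlackMonotone
import Summits.CriticalPhenomena.PercolationContinuityZ3.Theorems.PercNearOneGluingNoHeavyLowerTailSunflowerPromotion
import HarnessLib
import HarnessLib.Audit

/-!
# `NoHeavyLowerTail` (crux stmt-CriticalPhenomena-4575), abstract sunflower cubic, `k` petals: BOTTOM EXTENSION never increases `ZK` nor any `ZKflip D`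
# (all flip sets, including the corner `D = M`) — with `…MultiPetalDemotion` this is the SATURATION normal form for ★ₖ (all `k`) and for Conjecture G

Support file (seat `prim-l12-p2` gen 32; `--supports stmt-CriticalPhenomena-4575`; companion of `…SunflowerMultiPetalDemotionKey` (this gen: the pointwise keys
`two_kkK_le_s6K_dec_sub_petal₁/₂/₃`, refined keys `kkK_add_twK_le_s6K_dec_sub_petal₁/₂/₃`, `s6K_dd_sub_cc₁/₂/₃`, `sum_powerset_flipPair`, `lab_eq_of_mem_iff`) and
`…SunflowerMultiPetalDemotion` (kernel demotion, the dual move)).  Everything here is PROVED.  Memo: run/shared/lean/prim/prim-l12/prim-l12-p2/FINDING-g32.md §3.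

* `MSunflower.extend F M i₀` — BOTTOM EXTENSION: a bottom set `M` (in no `V j`) all of whose proper supersets lie in `V i₀` is added to `V i₀` (it becomes a
  minimal petal-`i₀` set).  `lab_extend_of_ne`, `lab_extend_self`, `lab_eq_zero_of_forall_not_memV`.
* **`ZKflip_extend_le`** (`D ≠ M`), **`ZKflip_extend_le_self`** (the corner `D = M`) and **`ZK_extend_le`**: the functional and all its flips do not increase —
  pointwise `s6K 0 y z − s6K c y z ≥ 2·kkK y z` (resp. `≥ kkK y z + twK y z` for the corner), summed over the antipodal pairs of the cube `2^{(M ∆ D)ᶜ}` with offset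
  `D ∩ (M ∆ D)`; in the corner the three double-empty partitions contribute `2·twK 0 (lab Mᶜ)` each and the pair `(M, Mᶜ)` balances (`kkK_add_twK_zero_left/right`, `twK_zero_comm`).
-/

namespace Summit.CriticalPhenomena.PercolationContinuityZ3.Theorems.SunflowerPartition

open Finset

variable {α : Type*} [DecidableEq α]

namespace MSunflower

variable {k : ℕ} (F : MSunflower k α)

/-! ## Bottom extension -/

/-- **BOTTOM EXTENSION** of `M` into petal `i₀`: add `M` to `V i₀`.  Legal when `M` lies in no `V j` and every proper superset of `M` lies in `V i₀`. [this work] -/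
def extend (M : Finset α) (i₀ : Fin k) (hsup : ∀ T : Finset α, M ⊂ T → T ∈ F.V i₀) (hB : ∀ j, M ∉ F.V j) : MSunflower k α where
  V j := if j = i₀ then insert M (F.V j) else F.V j
  A := F.A
  upperV := by
    intro j S T hST hS
    by_cases hj : j = i₀
    · subst hj
      have hS' : S ∈ insert M (F.V j) := by simpa using hS
      have : T ∈ insert M (F.V j) := by
        rcases mem_insert.1 hS' with rfl | hSV
        · by_cases hT : T = S
          · exact mem_insert.2 (Or.inl hT)
          · exact mem_insert.2 (Or.inr (hsup T (Finset.ssubset_iff_subset_ne.2 ⟨hST, fun h => hT h.symm⟩)))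
        · exact mem_insert.2 (Or.inr (F.upperV j hST hSV))
      simpa using this
    · have hS' : S ∈ F.V j := by simpa [hj] using hS
      have : T ∈ F.V j := F.upperV j hST hS'
      simpa [hj] using this
  upperA := F.upperA
  A_sub := by
    intro j S hS
    by_cases hj : j = i₀
    · have : S ∈ insert M (F.V j) := mem_insert.2 (Or.inr (F.A_sub j hS))
      simpa [hj] using this
    · have : S ∈ F.V j := F.A_sub j hS
      simpa [hj] using this
  inter_sub := by
    intro i j hij S hS
    rw [mem_inter] at hS
    obtain ⟨hSi, hSj⟩ := hS
    have memV : ∀ {l : Fin k}, S ∈ (if l = i₀ then insert M (F.V l) else F.V l) → S = M ∨ S ∈ F.V l := by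
      intro l h
      by_cases hl : l = i₀
      · have h' : S ∈ insert M (F.V l) := by simpa [hl] using h
        exact mem_insert.1 h'
      · have h' : S ∈ F.V l := by simpa [hl] using h
        exact Or.inr h'
    rcases memV hSi with rfl | hSi'
    · -- `S = M`: then `M ∈ V j` genuinely for the index `≠ i₀`, contradiction
      by_cases hi : i = i₀
      · have hj : j ≠ i₀ := fun h => hij (hi.trans h.symm)
        have : S ∈ F.V j := by simpa [hj] using hSj
        exact absurd this (hB j)
      · have : S ∈ F.V i := by simpa [hi] using hSi
        exact absurd this (hB i)
    · rcases memV hSj with rfl | hSj'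
      · exact absurd hSi' (hB i)
      · exact F.inter_sub i j hij (mem_inter.2 ⟨hSi', hSj'⟩)

section extend

variable (M : Finset α) (i₀ : Fin k) (hsup : ∀ T : Finset α, M ⊂ T → T ∈ F.V i₀) (hB : ∀ j, M ∉ F.V j)

/-- Sets other than `M` keep their label under extension. [this work] -/
theorem lab_extend_of_ne {S : Finset α} (hS : S ≠ M) : (F.extend M i₀ hsup hB).lab S = F.lab S := by
  refine (F.lab_eq_of_mem_iff (G := F.extend M i₀ hsup hB) Iff.rfl ?_).symm
  intro j
  show S ∈ F.V j ↔ S ∈ (if j = i₀ then insert M (F.V j) else F.V j)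
  by_cases hj : j = i₀
  · simp [hj, hS]
  · simp [hj]

/-- The extended bottom set carries the petal label `i₀`. [this work] -/
theorem lab_extend_self : (F.extend M i₀ hsup hB).lab M = petalLab k i₀ := by
  refine (F.extend M i₀ hsup hB).lab_eq_petalLab ?_ ?_
  · show M ∉ F.A
    exact fun h => hB i₀ (F.A_sub i₀ h)
  · show M ∈ (if i₀ = i₀ then insert M (F.V i₀) else F.V i₀)
    rw [if_pos rfl]; exact mem_insert_self M _

/-- A set in no `V j` has label `0` (given any petal index, so that `A ⊆ V i₀` applies). [this work] -/
theorem lab_eq_zero_of_forall_not_memV {S : Finset α} (i₀ : Fin k) (h : ∀ j, S ∉ F.V j) : F.lab S = 0 :=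
  (F.lab_eq_zero_iff S).2 ⟨fun hA => h i₀ (F.A_sub i₀ hA), h⟩

variable [Fintype α]

/-- The pointwise change of the (flipped) summand under bottom extension, split by which block is `X := M ∆ D`. [this work] -/
theorem extend_summand (D : Finset α) (hX : (symmDiff M D).Nonempty) {S T : Finset α} (hd : Disjoint S T) :
    s6K k (F.lab (symmDiff S D)) (F.lab (symmDiff T D)) (F.lab (symmDiff (S ∪ T)ᶜ D))
      - s6K k ((F.extend M i₀ hsup hB).lab (symmDiff S D)) ((F.extend M i₀ hsup hB).lab (symmDiff T D))
          ((F.extend M i₀ hsup hB).lab (symmDiff (S ∪ T)ᶜ D))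
      = (if S = symmDiff M D then s6K k 0 (F.lab (symmDiff T D)) (F.lab (symmDiff (S ∪ T)ᶜ D))
            - s6K k (petalLab k i₀) (F.lab (symmDiff T D)) (F.lab (symmDiff (S ∪ T)ᶜ D)) else 0)
        + (if T = symmDiff M D then s6K k (F.lab (symmDiff S D)) 0 (F.lab (symmDiff (S ∪ T)ᶜ D))
            - s6K k (F.lab (symmDiff S D)) (petalLab k i₀) (F.lab (symmDiff (S ∪ T)ᶜ D)) else 0)
        + (if (S ∪ T)ᶜ = symmDiff M D then s6K k (F.lab (symmDiff S D)) (F.lab (symmDiff T D)) 0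
            - s6K k (F.lab (symmDiff S D)) (F.lab (symmDiff T D)) (petalLab k i₀) else 0) := by
  have key : ∀ B : Finset α, symmDiff B D = M ↔ B = symmDiff M D := by
    intro B; constructor
    · intro h; rw [← h, symmDiff_symmDiff_cancel_right]
    · intro h; rw [h, symmDiff_symmDiff_cancel_right]
  have hFM : F.lab M = 0 := F.lab_eq_zero_of_forall_not_memV i₀ hB
  have hGM : (F.extend M i₀ hsup hB).lab M = petalLab k i₀ := F.lab_extend_self M i₀ hsup hB
  have hGne : ∀ B : Finset α, B ≠ symmDiff M D → (F.extend M i₀ hsup hB).lab (symmDiff B D) = F.lab (symmDiff B D) :=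
    fun B hB' => F.lab_extend_of_ne M i₀ hsup hB (fun h => hB' ((key B).1 h))
  by_cases h1 : S = symmDiff M D
  · have h2 : T ≠ symmDiff M D := Sunflower.snd_ne_of_fst_eq hX hd h1
    have h3 : (S ∪ T)ᶜ ≠ symmDiff M D := Sunflower.compl_ne_of_fst_eq hX h1
    have hS : symmDiff S D = M := (key S).2 h1
    rw [if_pos h1, if_neg h2, if_neg h3, hGne T h2, hGne (S ∪ T)ᶜ h3, hS, hFM, hGM]; ring
  by_cases h2 : T = symmDiff M D
  · have h3 : (S ∪ T)ᶜ ≠ symmDiff M D := Sunflower.compl_ne_of_snd_eq hX h2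
    have hT : symmDiff T D = M := (key T).2 h2
    rw [if_neg h1, if_pos h2, if_neg h3, hGne S h1, hGne (S ∪ T)ᶜ h3, hT, hFM, hGM]; ring
  by_cases h3 : (S ∪ T)ᶜ = symmDiff M D
  · have hU : symmDiff (S ∪ T)ᶜ D = M := (key _).2 h3
    rw [if_neg h1, if_neg h2, if_pos h3, hGne S h1, hGne T h2, hU, hFM, hGM]; ring
  · rw [if_neg h1, if_neg h2, if_neg h3, hGne S h1, hGne T h2, hGne (S ∪ T)ᶜ h3]; ring

/-- **BOTTOM EXTENSION NEVER INCREASES ANY FLIPPED FUNCTIONAL** (`X = M ∆ D` nonempty, i.e. `D ≠ M`): `(F.extend M i₀).ZKflip D ≤ F.ZKflip D`. [this work] -/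
theorem ZKflip_extend_le (D : Finset α) (hX : (symmDiff M D).Nonempty) :
    (F.extend M i₀ hsup hB).ZKflip D ≤ F.ZKflip D := by
  rw [← sub_nonneg]
  unfold ZKflip
  rw [← sum_sub_distrib]
  have hq : ∀ q ∈ parts α, Disjoint q.1 q.2 := fun q hq => (mem_filter.1 hq).2
  rw [sum_congr rfl fun q hqq => F.extend_summand M i₀ hsup hB D hX (hq q hqq)]
  rw [sum_add_distrib, sum_add_distrib]
  set X := symmDiff M D with hXdef
  have hp0 : petalLab k i₀ ≠ 0 := petalLab_ne_zero k i₀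
  have hpt : petalLab k i₀ ≠ Fin.last (k + 1) := petalLab_ne_last k i₀
  have htop : (0 : Fin (k + 2)) = Fin.last (k + 1) ∨ (0 : Fin (k + 2)) = 0 := Or.inr rfl
  rw [Sunflower.sum_parts_fst_eq X (fun T R => s6K k 0 (F.lab (symmDiff T D)) (F.lab (symmDiff R D))
        - s6K k (petalLab k i₀) (F.lab (symmDiff T D)) (F.lab (symmDiff R D))),
    Sunflower.sum_parts_snd_eq X (fun S R => s6K k (F.lab (symmDiff S D)) 0 (F.lab (symmDiff R D))
        - s6K k (F.lab (symmDiff S D)) (petalLab k i₀) (F.lab (symmDiff R D))),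
    Sunflower.sum_parts_thd_eq X (fun S T => s6K k (F.lab (symmDiff S D)) (F.lab (symmDiff T D)) 0
        - s6K k (F.lab (symmDiff S D)) (F.lab (symmDiff T D)) (petalLab k i₀))]
  -- the offset slack of the cube `Xᶜ`
  have hsl : 0 ≤ ∑ T ∈ (Xᶜ).powerset, 2 * kkK k (F.lab (symmDiff T D)) (F.lab (symmDiff (X ∪ T)ᶜ D)) := by
    rw [← mul_sum, sum_powerset_flipPair X D (fun P Q => kkK k (F.lab P) (F.lab Q))]
    exact mul_nonneg (by norm_num) (F.pslack_nonneg Xᶜ (D ∩ X))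
  have e2 : ∀ S ∈ (Xᶜ).powerset, (S ∪ X)ᶜ = (X ∪ S)ᶜ := fun S _ => by rw [union_comm]
  have e3 : ∀ S ∈ (Xᶜ).powerset, Xᶜ \ S = (X ∪ S)ᶜ := fun S _ => by rw [compl_union, sdiff_eq_inter_compl]
  have s1 : 0 ≤ ∑ T ∈ (Xᶜ).powerset, (s6K k 0 (F.lab (symmDiff T D)) (F.lab (symmDiff (X ∪ T)ᶜ D))
      - s6K k (petalLab k i₀) (F.lab (symmDiff T D)) (F.lab (symmDiff (X ∪ T)ᶜ D))) :=
    le_trans hsl (sum_le_sum fun T _ => two_kkK_le_s6K_dec_sub_petal₁ htop hp0 hpt _ _)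
  have s2 : 0 ≤ ∑ S ∈ (Xᶜ).powerset, (s6K k (F.lab (symmDiff S D)) 0 (F.lab (symmDiff (S ∪ X)ᶜ D))
      - s6K k (F.lab (symmDiff S D)) (petalLab k i₀) (F.lab (symmDiff (S ∪ X)ᶜ D))) := by
    refine le_trans hsl (sum_le_sum fun S hS => ?_)
    rw [e2 S hS]; exact two_kkK_le_s6K_dec_sub_petal₂ htop hp0 hpt _ _
  have s3 : 0 ≤ ∑ S ∈ (Xᶜ).powerset, (s6K k (F.lab (symmDiff S D)) (F.lab (symmDiff (Xᶜ \ S) D)) 0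
      - s6K k (F.lab (symmDiff S D)) (F.lab (symmDiff (Xᶜ \ S) D)) (petalLab k i₀)) := by
    refine le_trans hsl (sum_le_sum fun S hS => ?_)
    rw [e3 S hS]; exact two_kkK_le_s6K_dec_sub_petal₃ htop hp0 hpt _ _
  linarith

/-- **BOTTOM EXTENSION NEVER INCREASES `ZK`** (general-`k` version of the `k = 3` tree theorem `Sunflower.ZH_extend_le`). [this work] -/
theorem ZK_extend_le (hMne : M.Nonempty) : (F.extend M i₀ hsup hB).ZK ≤ F.ZK := by
  have h := F.ZKflip_extend_le M i₀ hsup hB ∅ (by rw [show symmDiff M ∅ = M from symmDiff_bot M]; exact hMne)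
  rwa [ZKflip_empty, ZKflip_empty] at h


omit [Fintype α] in
/-- `kkK 0 w + twK 0 w = 2·twK 0 w` (both sides are `2·[w = ⊤]`). [this work] -/
theorem kkK_add_twK_zero_left (w : Fin (k + 2)) :
    kkK k 0 w + twK k 0 w = 2 * twK k 0 w := by
  have hlt : (0 : Fin (k + 2)) ≠ Fin.last (k + 1) := by
    intro h; have := congrArg Fin.val h; simp at this
  unfold kkK twK
  simp only [hlt, false_and, if_false, ne_eq, not_true_eq_false, true_and, zero_add, and_false]
  split_ifs <;> omega

omit [Fintype α] in
/-- `kkK w 0 + twK w 0 = 2·twK 0 w`. [this work] -/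
theorem kkK_add_twK_zero_right (w : Fin (k + 2)) :
    kkK k w 0 + twK k w 0 = 2 * twK k 0 w := by
  have hlt : (0 : Fin (k + 2)) ≠ Fin.last (k + 1) := by
    intro h; have := congrArg Fin.val h; simp at this
  unfold kkK twK
  simp only [hlt, and_false, false_and, if_false, ne_eq, not_true_eq_false, and_true, true_and, zero_add, add_zero]
  split_ifs <;> omega

omit [Fintype α] in
/-- `twK w 0 = twK 0 w`. [this work] -/
theorem twK_zero_comm (w : Fin (k + 2)) : twK k w 0 = twK k 0 w := by
  have hlt : (0 : Fin (k + 2)) ≠ Fin.last (k + 1) := by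
    intro h; have := congrArg Fin.val h; simp at this
  unfold twK
  simp only [hlt, and_false, false_and, if_false, and_true, true_and, zero_add, add_zero]

/-- The pointwise change of the `M`-flipped summand under bottom extension of `M` itself, split by the pattern of empty blocks. [this work] -/
theorem extend_summand_self (hMne : M.Nonempty) {S T : Finset α} (hd : Disjoint S T) :
    s6K k (F.lab (symmDiff S M)) (F.lab (symmDiff T M)) (F.lab (symmDiff (S ∪ T)ᶜ M))
      - s6K k ((F.extend M i₀ hsup hB).lab (symmDiff S M)) ((F.extend M i₀ hsup hB).lab (symmDiff T M))
          ((F.extend M i₀ hsup hB).lab (symmDiff (S ∪ T)ᶜ M))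
      = (if S = ∅ then (if T ≠ ∅ ∧ (S ∪ T)ᶜ ≠ ∅ then
            s6K k 0 (F.lab (symmDiff T M)) (F.lab (symmDiff (S ∪ T)ᶜ M))
              - s6K k (petalLab k i₀) (F.lab (symmDiff T M)) (F.lab (symmDiff (S ∪ T)ᶜ M)) else 0) else 0)
        + (if T = ∅ then (if S ≠ ∅ ∧ (S ∪ T)ᶜ ≠ ∅ then
            s6K k (F.lab (symmDiff S M)) 0 (F.lab (symmDiff (S ∪ T)ᶜ M))
              - s6K k (F.lab (symmDiff S M)) (petalLab k i₀) (F.lab (symmDiff (S ∪ T)ᶜ M)) else 0) else 0)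
        + (if (S ∪ T)ᶜ = ∅ then (if S ≠ ∅ ∧ T ≠ ∅ then
            s6K k (F.lab (symmDiff S M)) (F.lab (symmDiff T M)) 0
              - s6K k (F.lab (symmDiff S M)) (F.lab (symmDiff T M)) (petalLab k i₀) else 0) else 0)
        + (if S = ∅ then (if T = ∅ then 2 * twK k 0 (F.lab Mᶜ) else 0) else 0)
        + (if S = ∅ then (if (S ∪ T)ᶜ = ∅ then 2 * twK k 0 (F.lab Mᶜ) else 0) else 0)
        + (if T = ∅ then (if (S ∪ T)ᶜ = ∅ then 2 * twK k 0 (F.lab Mᶜ) else 0) else 0) := by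
  set G := F.extend M i₀ hsup hB with hG
  have hp0 : petalLab k i₀ ≠ 0 := petalLab_ne_zero k i₀
  have hpt : petalLab k i₀ ≠ Fin.last (k + 1) := petalLab_ne_last k i₀
  have htop : (0 : Fin (k + 2)) = Fin.last (k + 1) ∨ (0 : Fin (k + 2)) = 0 := Or.inr rfl
  have hFM : F.lab M = 0 := F.lab_eq_zero_of_forall_not_memV i₀ hB
  have hGM : G.lab M = petalLab k i₀ := F.lab_extend_self M i₀ hsup hB
  have he : symmDiff (∅ : Finset α) M = M := symmDiff_eq_right.2 rfl
  have hne : ∀ B : Finset α, B ≠ ∅ → G.lab (symmDiff B M) = F.lab (symmDiff B M) :=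
    fun B hB' => F.lab_extend_of_ne M i₀ hsup hB (fun h => hB' (symmDiff_eq_right.1 h))
  have huniv : (univ : Finset α) ≠ ∅ := by
    obtain ⟨x, _⟩ := hMne
    exact fun h => absurd (mem_univ x) (by rw [h]; exact notMem_empty x)
  have hw : F.lab (symmDiff univ M) = F.lab Mᶜ := by rw [symmDiff_univ_eq_compl]
  by_cases hS : S = ∅
  · subst hS
    by_cases hT : T = ∅
    · subst hT
      have hR : ((∅ : Finset α) ∪ ∅)ᶜ = univ := by simp
      have hR' : ((∅ : Finset α) ∪ ∅)ᶜ ≠ ∅ := by rw [hR]; exact huniv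
      simp only [if_true, ne_eq, not_true_eq_false, false_and, and_false, if_false, hR', zero_add, add_zero]
      rw [hR, he, hFM, hGM, hne univ huniv, hw]
      exact F.lab Mᶜ |> fun _ => s6K_dd_sub_cc₁ htop hp0 hpt _
    · by_cases hR : ((∅ : Finset α) ∪ T)ᶜ = ∅
      · have hTu : T = univ := by rwa [empty_union, Finset.compl_eq_empty_iff] at hR
        simp only [if_true, hT, hR, ne_eq, not_true_eq_false, not_false_eq_true, and_false, and_true, if_false, zero_add, add_zero]
        rw [he, hFM, hGM, hne T hT, hTu, hw]
        exact s6K_dd_sub_cc₂ htop hp0 hpt _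
      · simp only [if_true, hT, hR, ne_eq, not_false_eq_true, and_self, if_false, add_zero]
        rw [he, hFM, hGM, hne T hT, hne _ hR]
  · by_cases hT : T = ∅
    · subst hT
      by_cases hR : (S ∪ (∅ : Finset α))ᶜ = ∅
      · have hSu : S = univ := by rwa [union_empty, Finset.compl_eq_empty_iff] at hR
        simp only [hS, if_false, if_true, hR, ne_eq, not_true_eq_false, and_false, zero_add, add_zero, not_false_eq_true]
        rw [he, hFM, hGM, hne S hS, hSu, hw]
        exact s6K_dd_sub_cc₃ htop hp0 hpt _
      · simp only [hS, if_false, if_true, hR, ne_eq, not_false_eq_true, and_self, zero_add, add_zero]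
        rw [he, hFM, hGM, hne S hS, hne _ hR]
    · by_cases hR : (S ∪ T)ᶜ = ∅
      · simp only [hS, hT, hR, if_false, if_true, ne_eq, not_false_eq_true, and_self, zero_add, add_zero]
        rw [he, hFM, hGM, hne S hS, hne T hT]
      · simp only [hS, hT, hR, if_false, add_zero]
        rw [hne S hS, hne T hT, hne _ hR, sub_self]

/-- **BOTTOM EXTENSION NEVER INCREASES THE `M`-FLIPPED FUNCTIONAL** (the corner `D = M` of `ZKflip_extend_le`). [this work] -/
theorem ZKflip_extend_le_self (hMne : M.Nonempty) :
    (F.extend M i₀ hsup hB).ZKflip M ≤ F.ZKflip M := by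
  rw [← sub_nonneg]
  unfold ZKflip
  rw [← sum_sub_distrib]
  have hq : ∀ q ∈ parts α, Disjoint q.1 q.2 := fun q hq => (mem_filter.1 hq).2
  rw [sum_congr rfl fun q hqq => F.extend_summand_self M i₀ hsup hB hMne (hq q hqq)]
  rw [sum_add_distrib, sum_add_distrib, sum_add_distrib, sum_add_distrib, sum_add_distrib]
  set t : Fin (k + 2) := (0 : Fin (k + 2)) with ht
  set c : Fin (k + 2) := petalLab k i₀ with hc
  set tw : ℤ := twK k 0 (F.lab Mᶜ) with htw
  have hp0 : c ≠ 0 := petalLab_ne_zero k i₀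
  have hpt : c ≠ Fin.last (k + 1) := petalLab_ne_last k i₀
  have htop : t = Fin.last (k + 1) ∨ t = (0 : Fin (k + 2)) := Or.inr rfl
  have huniv : (univ : Finset α) ≠ ∅ := by
    obtain ⟨x, _⟩ := hMne
    exact fun h => absurd (mem_univ x) (by rw [h]; exact notMem_empty x)
  have he : symmDiff (∅ : Finset α) M = M := symmDiff_eq_right.2 rfl
  have hFM : F.lab M = t := F.lab_eq_zero_of_forall_not_memV i₀ hB
  -- the six block sums
  rw [Sunflower.sum_parts_fst_eq ∅ (fun T R => if T ≠ ∅ ∧ R ≠ ∅ then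
        s6K k t (F.lab (symmDiff T M)) (F.lab (symmDiff R M)) - s6K k c (F.lab (symmDiff T M)) (F.lab (symmDiff R M)) else 0),
    Sunflower.sum_parts_snd_eq ∅ (fun S R => if S ≠ ∅ ∧ R ≠ ∅ then
        s6K k (F.lab (symmDiff S M)) t (F.lab (symmDiff R M)) - s6K k (F.lab (symmDiff S M)) c (F.lab (symmDiff R M)) else 0),
    Sunflower.sum_parts_thd_eq ∅ (fun S T => if S ≠ ∅ ∧ T ≠ ∅ then
        s6K k (F.lab (symmDiff S M)) (F.lab (symmDiff T M)) t - s6K k (F.lab (symmDiff S M)) (F.lab (symmDiff T M)) c else 0),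
    Sunflower.sum_parts_fst_eq ∅ (fun T _ => if T = ∅ then 2 * tw else 0),
    Sunflower.sum_parts_fst_eq ∅ (fun _ R => if R = ∅ then 2 * tw else 0),
    Sunflower.sum_parts_snd_eq ∅ (fun _ R => if R = ∅ then 2 * tw else 0)]
  simp only [empty_union, union_empty, compl_empty, powerset_univ]
  -- the pair functional P(T) = kkK + twK on the flipped antipodal pair (T ∆ M, Tᶜ ∆ M)
  set P : Finset α → ℤ := fun T => kkK k (F.lab (symmDiff T M)) (F.lab (symmDiff Tᶜ M)) + twK k (F.lab (symmDiff T M)) (F.lab (symmDiff Tᶜ M)) with hP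
  have hPe : P ∅ = 2 * tw := by
    simp only [hP, he, compl_empty, symmDiff_univ_eq_compl, hFM, ht]
    exact kkK_add_twK_zero_left _
  have hPu : P univ = 2 * tw := by
    simp only [hP, symmDiff_univ_eq_compl, Finset.compl_univ, he, hFM, ht, htw]
    rw [kkK_add_twK_zero_right]
  have hcu : ∀ T : Finset α, Tᶜ = ∅ ↔ T = univ := fun T => Finset.compl_eq_empty_iff T
  have hus : ∀ S : Finset α, univ \ S = Sᶜ := fun S => (compl_eq_univ_sdiff S).symm
  -- (1) the three single-empty sums dominate Σ P − 4 tw each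
  have key₁ : ∀ T : Finset α, P T - (if T = ∅ then 2 * tw else 0) - (if Tᶜ = ∅ then 2 * tw else 0)
      ≤ (if T ≠ ∅ ∧ Tᶜ ≠ ∅ then s6K k t (F.lab (symmDiff T M)) (F.lab (symmDiff Tᶜ M)) - s6K k c (F.lab (symmDiff T M)) (F.lab (symmDiff Tᶜ M)) else 0) := by
    intro T
    by_cases hT : T = ∅
    · subst hT
      simp only [if_true, compl_empty, huniv, if_false, ne_eq, not_true_eq_false, false_and, sub_zero, hPe]; norm_num
    · by_cases hTc : Tᶜ = ∅
      · have hTu : T = univ := (hcu T).1 hTc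
        subst hTu
        simp only [hT, if_false, hTc, if_true, ne_eq, not_true_eq_false, and_false, sub_zero, hPu]; norm_num
      · simp only [hT, hTc, if_false, ne_eq, not_false_eq_true, and_self, if_true, sub_zero]
        exact kkK_add_twK_le_s6K_dec_sub_petal₁ htop hp0 hpt _ _
  have key₂ : ∀ S : Finset α, P S - (if S = ∅ then 2 * tw else 0) - (if Sᶜ = ∅ then 2 * tw else 0)
      ≤ (if S ≠ ∅ ∧ Sᶜ ≠ ∅ then s6K k (F.lab (symmDiff S M)) t (F.lab (symmDiff Sᶜ M)) - s6K k (F.lab (symmDiff S M)) c (F.lab (symmDiff Sᶜ M)) else 0) := by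
    intro T
    by_cases hT : T = ∅
    · subst hT
      simp only [if_true, compl_empty, huniv, if_false, ne_eq, not_true_eq_false, false_and, sub_zero, hPe]; norm_num
    · by_cases hTc : Tᶜ = ∅
      · have hTu : T = univ := (hcu T).1 hTc
        subst hTu
        simp only [hT, if_false, hTc, if_true, ne_eq, not_true_eq_false, and_false, sub_zero, hPu]; norm_num
      · simp only [hT, hTc, if_false, ne_eq, not_false_eq_true, and_self, if_true, sub_zero]
        exact kkK_add_twK_le_s6K_dec_sub_petal₂ htop hp0 hpt _ _
  have key₃ : ∀ S : Finset α, P S - (if S = ∅ then 2 * tw else 0) - (if Sᶜ = ∅ then 2 * tw else 0)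
      ≤ (if S ≠ ∅ ∧ Sᶜ ≠ ∅ then s6K k (F.lab (symmDiff S M)) (F.lab (symmDiff Sᶜ M)) t - s6K k (F.lab (symmDiff S M)) (F.lab (symmDiff Sᶜ M)) c else 0) := by
    intro T
    by_cases hT : T = ∅
    · subst hT
      simp only [if_true, compl_empty, huniv, if_false, ne_eq, not_true_eq_false, false_and, sub_zero, hPe]; norm_num
    · by_cases hTc : Tᶜ = ∅
      · have hTu : T = univ := (hcu T).1 hTc
        subst hTu
        simp only [hT, if_false, hTc, if_true, ne_eq, not_true_eq_false, and_false, sub_zero, hPu]; norm_num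
      · simp only [hT, hTc, if_false, ne_eq, not_false_eq_true, and_self, if_true, sub_zero]
        exact kkK_add_twK_le_s6K_dec_sub_petal₃ htop hp0 hpt _ _
  -- (2) the indicator sums
  have hIe : ∑ T : Finset α, (if T = ∅ then 2 * tw else 0) = 2 * tw := by
    rw [sum_ite_eq' univ (∅ : Finset α) (fun _ => 2 * tw)]; simp
  have hIu : ∑ T : Finset α, (if Tᶜ = ∅ then 2 * tw else 0) = 2 * tw := by
    have : ∀ T : Finset α, (if Tᶜ = ∅ then 2 * tw else 0) = (if T = univ then 2 * tw else 0) := fun T => by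
      rw [if_congr (hcu T) rfl rfl]
    rw [sum_congr rfl fun T _ => this T, sum_ite_eq' univ (univ : Finset α) (fun _ => 2 * tw)]; simp
  -- (3) Σ P ≥ 2 tw : the kk-part is an antipodal Gladkov sum (reindexed by T ↦ T ∆ M), the tw-part contains the terms T = ∅, univ
  have hkk : 0 ≤ ∑ T : Finset α, kkK k (F.lab (symmDiff T M)) (F.lab (symmDiff Tᶜ M)) := by
    have hg := F.antipodal_gladkov (univ : Finset α)
    rw [powerset_univ] at hg
    refine le_of_le_of_eq hg ?_
    refine sum_nbij' (fun U => symmDiff U M) (fun T => symmDiff T M) ?_ ?_ ?_ ?_ ?_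
    · intro U _; exact mem_univ _
    · intro T _; exact mem_univ _
    · intro U _; exact symmDiff_symmDiff_cancel_right _ _
    · intro T _; exact symmDiff_symmDiff_cancel_right _ _
    · intro U _
      rw [symmDiff_compl_left, symmDiff_symmDiff_cancel_right, hus]
  have htwsum : 2 * tw ≤ ∑ T : Finset α, twK k (F.lab (symmDiff T M)) (F.lab (symmDiff Tᶜ M)) := by
    have hsub : ({∅, univ} : Finset (Finset α)) ⊆ univ := subset_univ _
    have h2 := sum_le_sum_of_subset_of_nonneg hsub (fun T _ _ => twK_nonneg k (F.lab (symmDiff T M)) (F.lab (symmDiff Tᶜ M)))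
    have hne : (∅ : Finset α) ≠ univ := fun h => huniv h.symm
    rw [sum_pair hne] at h2
    refine le_trans (le_of_eq ?_) h2
    rw [he, compl_empty, symmDiff_univ_eq_compl, Finset.compl_univ, he, hFM, ht, twK_zero_comm, ← htw]; ring
  have hPsum : 2 * tw ≤ ∑ T : Finset α, P T := by
    simp only [hP]
    rw [sum_add_distrib]
    linarith
  -- (4) assemble
  have s1 := sum_le_sum fun T (_ : T ∈ (univ : Finset (Finset α))) => key₁ T
  have s2 := sum_le_sum fun T (_ : T ∈ (univ : Finset (Finset α))) => key₂ T
  have s3 := sum_le_sum fun T (_ : T ∈ (univ : Finset (Finset α))) => key₃ T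
  rw [sum_sub_distrib, sum_sub_distrib, hIe, hIu] at s1 s2 s3
  simp only [hus]
  linarith

end extend

end MSunflower

end Summit.CriticalPhenomena.PercolationContinuityZ3.Theorems.SunflowerPartition
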